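import Summits.FinalStateConjecture.FinalStateConjecture.Theorems.EIHFluxBalanceInertialRecessionVirialSmooth

/-!
# Route EIHFluxBalance — crux `InertialRecession`, abstract endgame: toward the VISIT LEMMA (N = 3 doubly-bad case)

Helper file for the crux `stmt-FinalStateConjecture-10166` (virial route, `work/split/PLAN.md` §"N = 3 doubly-bad case").
Mathlib-only, static algebra. For a member set `s` with velocities `‖vⱼ‖ ≤ k < 1`: every member velocity is within
`(1 + 2Γ⁸) · (max relative velocity)` of the COLD velocity `V̂ = P/√(M² + ‖P‖²)` of the set
(`norm_sub_coldVelocity_le_of_relative`): `‖vⱼ − P/E‖ ≤ maxₗ ‖vⱼ − v_l‖` (convex combination) and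
`‖P/E − V̂‖ ≤ K/M ≤ (2Γ⁸/M²)σ₂` (`internalEnergy_le'`). So a nearly co-moving pair has both velocities frozen onto its frozen
cold velocity — the "turning" half of the visit analysis.
-/

noncomputable section

open Finset

namespace Summit.FinalStateConjecture.FinalStateConjecture.Theorems.SublinearIsFree.Virial

open Literature.Geometry.Lorentzian

/-- A member velocity is within the velocity spread of the energy-weighted mean velocity `P/E`. [folklore] -/
theorem norm_sub_meanVelocity_le {ι : Type*} (s : Finset ι) (E : ι → ℝ) (v : ι → E3) (hE : ∀ i ∈ s, 0 < E i)
    {j : ι} (hj : j ∈ s) {w : ℝ} (hw : ∀ l ∈ s, ‖v j - v l‖ ≤ w) :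
    ‖v j - (∑ i ∈ s, E i)⁻¹ • ∑ i ∈ s, E i • v i‖ ≤ w := by
  have hEs : 0 < ∑ i ∈ s, E i := Finset.sum_pos hE ⟨j, hj⟩
  have hw0 : 0 ≤ w := (norm_nonneg _).trans (hw j hj)
  have key : v j - (∑ i ∈ s, E i)⁻¹ • ∑ i ∈ s, E i • v i = (∑ i ∈ s, E i)⁻¹ • ∑ i ∈ s, E i • (v j - v i) := by
    have h1 : ∑ i ∈ s, E i • (v j - v i) = (∑ i ∈ s, E i) • v j - ∑ i ∈ s, E i • v i := by
      simp only [smul_sub, Finset.sum_sub_distrib, Finset.sum_smul]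
    rw [h1, smul_sub, smul_smul, inv_mul_cancel₀ hEs.ne', one_smul]
  rw [key, norm_smul, Real.norm_eq_abs, abs_of_pos (inv_pos.mpr hEs)]
  calc (∑ i ∈ s, E i)⁻¹ * ‖∑ i ∈ s, E i • (v j - v i)‖
      ≤ (∑ i ∈ s, E i)⁻¹ * ∑ i ∈ s, E i * w := by
        refine mul_le_mul_of_nonneg_left ((norm_sum_le _ _).trans (Finset.sum_le_sum fun i hi ↦ ?_))
          (inv_pos.mpr hEs).le
        rw [norm_smul, Real.norm_eq_abs, abs_of_pos (hE i hi)]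
        exact mul_le_mul_of_nonneg_left (hw i hi) (hE i hi).le
    _ = w := by rw [← Finset.sum_mul]; field_simp

/-- The energy-weighted mean velocity is within `K/M` of the cold velocity: `‖P/E − P/√(M² + ‖P‖²)‖ ≤ (E − √(M²+‖P‖²))/M`.
[folklore] -/
theorem norm_meanVelocity_sub_coldVelocity_le {E MB : ℝ} (P : E3) (hMB : 0 < MB) (hE : √(MB ^ 2 + ‖P‖ ^ 2) ≤ E) :
    ‖E⁻¹ • P - (√(MB ^ 2 + ‖P‖ ^ 2))⁻¹ • P‖ ≤ (E - √(MB ^ 2 + ‖P‖ ^ 2)) / MB := by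
  have hC : MB ≤ √(MB ^ 2 + ‖P‖ ^ 2) := by
    rw [Real.le_sqrt hMB.le (by positivity)]; nlinarith [norm_nonneg P]
  have hPC : ‖P‖ ≤ √(MB ^ 2 + ‖P‖ ^ 2) := by
    rw [Real.le_sqrt (norm_nonneg _) (by positivity)]; nlinarith [sq_nonneg MB]
  have hC0 : 0 < √(MB ^ 2 + ‖P‖ ^ 2) := hMB.trans_le hC
  have hE0 : 0 < E := hC0.trans_le hE
  rw [← sub_smul, norm_smul, Real.norm_eq_abs]
  have h1 : |E⁻¹ - (√(MB ^ 2 + ‖P‖ ^ 2))⁻¹| = (E - √(MB ^ 2 + ‖P‖ ^ 2)) / (E * √(MB ^ 2 + ‖P‖ ^ 2)) := by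
    rw [abs_of_nonpos (by rw [sub_nonpos]; exact inv_anti₀ hC0 hE)]
    field_simp
    ring
  rw [h1, div_mul_eq_mul_div, div_le_div_iff₀ (mul_pos hE0 hC0) hMB]
  have h2 : 0 ≤ E - √(MB ^ 2 + ‖P‖ ^ 2) := by linarith
  calc (E - √(MB ^ 2 + ‖P‖ ^ 2)) * ‖P‖ * MB ≤ (E - √(MB ^ 2 + ‖P‖ ^ 2)) * √(MB ^ 2 + ‖P‖ ^ 2) * E := by
        have := mul_le_mul hPC (hC.trans hE) hMB.le hC0.le
        nlinarith [h2, this]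
    _ = (E - √(MB ^ 2 + ‖P‖ ^ 2)) * (E * √(MB ^ 2 + ‖P‖ ^ 2)) := by ring

/-- **A member velocity is within `(1 + 2Γ⁸|s|²)·w` of the cold velocity when all relative velocities are `≤ w`.** [folklore] -/
theorem norm_sub_coldVelocity_le_of_relative {ι : Type*} (s : Finset ι) (M : ι → ℝ) (v : ι → E3) {k : ℝ}
    (hM : ∀ i ∈ s, 0 < M i) (hk : k < 1) (hv : ∀ i ∈ s, ‖v i‖ ≤ k) {j : ι} (hj : j ∈ s) {w : ℝ}
    (hw : ∀ i ∈ s, ∀ l ∈ s, ‖v i - v l‖ ≤ w) :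
    ‖v j - (√((∑ i ∈ s, M i) ^ 2 + ‖∑ i ∈ s, (M i * (√(1 - ‖v i‖ ^ 2))⁻¹) • v i‖ ^ 2))⁻¹ •
        ∑ i ∈ s, (M i * (√(1 - ‖v i‖ ^ 2))⁻¹) • v i‖ ≤
      w + 2 * ((√(1 - k ^ 2))⁻¹) ^ 8 * s.card ^ 2 * w ^ 2 := by
  classical
  have hs : s.Nonempty := ⟨j, hj⟩
  have hk0 : 0 ≤ k := (norm_nonneg _).trans (hv j hj)
  have hk2 : 0 < 1 - k ^ 2 := by nlinarith
  have hw0 : 0 ≤ w := (norm_nonneg _).trans (hw j hj j hj)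
  have hγ0 : ∀ i ∈ s, 0 < (√(1 - ‖v i‖ ^ 2))⁻¹ := fun i hi ↦
    inv_pos.mpr (Real.sqrt_pos.mpr (by nlinarith [hv i hi, norm_nonneg (v i), hk0]))
  set E : ι → ℝ := fun i ↦ M i * (√(1 - ‖v i‖ ^ 2))⁻¹ with hEdef
  have hE : ∀ i ∈ s, 0 < E i := fun i hi ↦ mul_pos (hM i hi) (hγ0 i hi)
  have hMB : 0 < ∑ i ∈ s, M i := Finset.sum_pos hM hs
  -- step 1: to the mean velocity
  have h1 : ‖v j - (∑ i ∈ s, E i)⁻¹ • ∑ i ∈ s, E i • v i‖ ≤ w :=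
    norm_sub_meanVelocity_le s E v hE hj fun l hl ↦ hw j hj l hl
  -- step 2: mean to cold
  have hKge := internalEnergy_ge' s M (fun i ↦ E i • v i) hM hs
  have hEi : ∀ i ∈ s, √((M i) ^ 2 + ‖E i • v i‖ ^ 2) = E i := fun i hi ↦
    sqrt_sq_add_norm_lorentzMomentum (hM i hi).le ((hv i hi).trans_lt hk)
  rw [Finset.sum_congr rfl hEi] at hKge
  have hK0 : √((∑ i ∈ s, M i) ^ 2 + ‖∑ i ∈ s, E i • v i‖ ^ 2) ≤ ∑ i ∈ s, E i := by
    have : 0 ≤ ∑ j ∈ s, (M j) ^ 2 * ‖E j • v j - (M j / ∑ i ∈ s, M i) • ∑ i ∈ s, E i • v i‖ ^ 2 /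
        (2 * √((M j) ^ 2 + ‖E j • v j‖ ^ 2) * (√((M j) ^ 2 + ‖(M j / ∑ i ∈ s, M i) • ∑ i ∈ s, E i • v i‖ ^ 2)) ^ 2) :=
      Finset.sum_nonneg fun i _ ↦ by positivity
    linarith
  have h2 := norm_meanVelocity_sub_coldVelocity_le (∑ i ∈ s, E i • v i) hMB hK0
  have hKle := internalEnergy_le' s M v hM hk hv hs
  -- the spread bound `σ₂ ≤ |s|² M-weighted w²`: `Σ Mⱼ M_l ‖vⱼ − v_l‖² ≤ (Σ M)² w²`
  have hσ : ∑ a ∈ s, ∑ b ∈ s, M a * M b * ‖v a - v b‖ ^ 2 ≤ (∑ i ∈ s, M i) ^ 2 * w ^ 2 := by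
    calc ∑ a ∈ s, ∑ b ∈ s, M a * M b * ‖v a - v b‖ ^ 2 ≤ ∑ a ∈ s, ∑ b ∈ s, M a * M b * w ^ 2 :=
          Finset.sum_le_sum fun a ha ↦ Finset.sum_le_sum fun b hb ↦
            mul_le_mul_of_nonneg_left (pow_le_pow_left₀ (norm_nonneg _) (hw a ha b hb) 2)
              (mul_pos (hM a ha) (hM b hb)).le
      _ = (∑ i ∈ s, M i) ^ 2 * w ^ 2 := by
          rw [show (∑ i ∈ s, M i) ^ 2 = (∑ i ∈ s, M i) * ∑ i ∈ s, M i from sq _, Finset.sum_mul_sum, Finset.sum_mul]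
          refine Finset.sum_congr rfl fun a _ ↦ ?_
          rw [Finset.sum_mul]
  -- combine
  have hcold : ‖(∑ i ∈ s, E i)⁻¹ • ∑ i ∈ s, E i • v i -
      (√((∑ i ∈ s, M i) ^ 2 + ‖∑ i ∈ s, E i • v i‖ ^ 2))⁻¹ • ∑ i ∈ s, E i • v i‖ ≤
      2 * ((√(1 - k ^ 2))⁻¹) ^ 8 * s.card ^ 2 * w ^ 2 := by
    refine h2.trans ?_
    rw [div_le_iff₀ hMB]
    have h3 : (∑ i ∈ s, E i) - √((∑ i ∈ s, M i) ^ 2 + ‖∑ i ∈ s, E i • v i‖ ^ 2) ≤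
        2 * ((√(1 - k ^ 2))⁻¹) ^ 8 / (∑ i ∈ s, M i) * ((∑ i ∈ s, M i) ^ 2 * w ^ 2) :=
      hKle.trans (mul_le_mul_of_nonneg_left hσ (by positivity))
    have h4 : 2 * ((√(1 - k ^ 2))⁻¹) ^ 8 / (∑ i ∈ s, M i) * ((∑ i ∈ s, M i) ^ 2 * w ^ 2) =
        2 * ((√(1 - k ^ 2))⁻¹) ^ 8 * w ^ 2 * ∑ i ∈ s, M i := by field_simp
    have h5 : (1 : ℝ) ≤ s.card ^ 2 := by
      have : (1 : ℝ) ≤ s.card := by exact_mod_cast hs.card_pos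
      nlinarith
    have h6 : 0 ≤ 2 * ((√(1 - k ^ 2))⁻¹) ^ 8 * w ^ 2 * ∑ i ∈ s, M i := by positivity
    nlinarith [h3, h4, h5, h6]
  calc ‖v j - (√((∑ i ∈ s, M i) ^ 2 + ‖∑ i ∈ s, E i • v i‖ ^ 2))⁻¹ • ∑ i ∈ s, E i • v i‖
      ≤ ‖v j - (∑ i ∈ s, E i)⁻¹ • ∑ i ∈ s, E i • v i‖ +
        ‖(∑ i ∈ s, E i)⁻¹ • ∑ i ∈ s, E i • v i -
          (√((∑ i ∈ s, M i) ^ 2 + ‖∑ i ∈ s, E i • v i‖ ^ 2))⁻¹ • ∑ i ∈ s, E i • v i‖ :=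
        norm_sub_le_norm_sub_add_norm_sub _ _ _
    _ ≤ w + 2 * ((√(1 - k ^ 2))⁻¹) ^ 8 * s.card ^ 2 * w ^ 2 := add_le_add h1 hcold

/-- Registered one-line form of `norm_sub_meanVelocity_le`. [folklore] -/
theorem norm_sub_meanVelocity_le' : open Literature.Geometry.Lorentzian Finset in ∀ {ι : Type*} (s : Finset ι) (E : ι → ℝ) (v : ι → E3), (∀ i ∈ s, 0 < E i) → ∀ {j : ι}, j ∈ s → ∀ {w : ℝ}, (∀ l ∈ s, ‖v j - v l‖ ≤ w) → ‖v j - (∑ i ∈ s, E i)⁻¹ • ∑ i ∈ s, E i • v i‖ ≤ w :=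
  fun s E v hE _ hj _ hw ↦ norm_sub_meanVelocity_le s E v hE hj hw

end Summit.FinalStateConjecture.FinalStateConjecture.Theorems.SublinearIsFree.Virial

end
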